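import Summits.BirchSwinnertonDyer.Rank1Residual.P2.CMKolyvaginPointSystemOddTamagawaAtTwo
import HarnessLib

/-!
# Route `CMKolyvaginAtInertTwo`, crux `CMKolyvaginConjectureAtInertTwo` (stmt-BirchSwinnertonDyer-24648),
# stub `stub_positiveDepth` — THE MACHINE'S POINT SYSTEM WITH ROOTS, RE-RUN WITH THE FRAME AS INPUT
# (census option (α1) of hand 8 / host g43: hand 7's `PointSystemWithRoots.hpoints_at_with_roots_of_perLevelChoice`
# with its line 167 — `KolyvaginBottom.exists_frame_of_isHeegnerPoint`, the ONLY place the machine chooses a frame —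
# replaced by the GIVEN frame `(Dt, β, ι)` of the crux, so that the root clause (r) speaks about Kolyvagin–Heegner data
# `e : KolyvaginHeegnerData Dt β ι m` ON THAT FRAME and nothing else)

Seat `leafhand-bsd-cmkolyvaginatinert-9` g0 (cell `bsd-eis`); helper `--supports stmt-BirchSwinnertonDyer-24648`
(brief `BRIEF-cmk-9-alpha1-OnGivenFrame`, file F1).  THEOREMS ONLY: no definition, no named fact, no `sorry`; nothing
is closed; BSD is proved for no curve.

WHAT.  Hand 7's assembly (ty2's `PointSystemHloc.hpoints_at_of_perLevelChoice_of_admissible_of_h44_of_hloc` + the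
root clause (r)) builds its coherent tower of Kolyvagin–Heegner data on a frame `(Dt', β', ι')` it OBTAINS from the
consumer's `IsHeegnerPoint N W K P` (x11b3-p1 `exists_frame_of_isHeegnerPoint`, modulo Shimura reciprocity `hrec`),
so its clause (r) must quantify over ALL frames, and every consumer downstream (hand 7's converse, hand 8's files
#1 §6 / #2 §2 / #4) returns its witnessing datum on the machine's frame, not on the crux's.  Here the frame is an
INPUT: the assembly takes `(Dt, β, ι)`, the orientation congruence `4N ∣ β² − d_K` (`hβ`) and clause (c) on the frame
(`hc1 : ∀ d : KolyvaginHeegnerData Dt β ι 1, d.toGeomPoints d.derivedPoint = toGeomPoints P`) and runs TOKEN FOR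
TOKEN as before; `hrec` disappears (it served only the frame choice).
* §0 `derivedPoint_eq_of_conductor_one`, `toGeomPoints_derivedPoint_one_eq_of_map_eq` — clause (c) on the given
  frame from the stub's data: a conductor-`1` datum `d₁` and a `K`-rational `P` under `P(1)` (hand 8's
  `…EpsilonLineOnHTwo` §1) give `hc1` for EVERY conductor-`1` datum on `(Dt, β, ι)` (`P(1)` is datum-free: `S = 𝒢_1`,
  `y(1)` pinned by `map_y`); `hβ` is the field `d₁.dvd_sq_sub`.  Unconditional.
* §1 `hpoints_at_with_roots_onFrame_of_perLevelChoice` — the assembly at any prime `p` ON THE GIVEN FRAME, with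
  clause (r) «`∀ k, (∀ e : KolyvaginHeegnerData Dt β ι m, ∃ Q₀, p^k Q₀ = P_e(m)) → ∃ Q ∈ A m, p^k Q = P_m`» and the
  new clause (s) «`∃ e : KolyvaginHeegnerData Dt β ι m, A m = e.pointsSubgroup ∧ P_m = e.toGeomPoints (P_e(m))`»
  (the tower's level-`m` datum IS a datum on the given frame).

HONEST FRAMING: a RE-THREADING of hand 7's / ty2's theorem (proof verbatim, one `obtain` turned into hypotheses,
+ clause (s)); no new mathematics; the printed / named inputs are exactly ty2's.  The `p = 2` specialisation on H₂,
the refined `(−ε)`-descent and Kolyvagin's converse ON THE GIVEN FRAME are the next file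
(`…MinusPartRefinedDescentOnGivenFrameAtTwoPow`); the depth-one statement with the crux's conclusion verbatim is the
one after.  References: [GrossLMS1991] §3 Props. 3.6, 3.7, §4 (4.1) and the remark `P_1 = y_K`, Lemma 4.3,
Props. 5.3, 5.4 (1), 6.2; [McCallumLMS1991] §4 (4)–(6), Lemma 4.3, Prop. 4.4, §5 (before Prop. 5.2); [Darmon2004]
Thm. 3.7, Prop. 3.11.
presearch: tree re-keying only (the assembly is ty2's / hand 7's; `lean search 'onFrame'` / `'OnGivenFrame'` → none).
-/

-- single-conjunct summit: `Summit.BirchSwinnertonDyer.BirchSwinnertonDyer.…` repeats the name by design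
set_option linter.dupNamespace false
set_option autoImplicit false

noncomputable section

open scoped Classical
open WeierstrassCurve Field NumberField IsDedekindDomain Finset
open Literature.NumberTheory.EllipticCurves Literature.NumberTheory.GaloisRepresentations
open Literature.NumberTheory.EllipticCurves.KolyvaginCocycle
open Literature.NumberTheory.EllipticCurves.KolyvaginEuler
open Literature.NumberTheory.EllipticCurves.RingClassField
open Literature.NumberTheory.EllipticCurves.ModularForms
open Summit.BirchSwinnertonDyer.Rank1Residual.X11b
open Summit.BirchSwinnertonDyer.Rank1Residual.X11b.KolyvaginAssembly
open Summit.BirchSwinnertonDyer.Rank1Residual.P2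

namespace Summit.BirchSwinnertonDyer.BirchSwinnertonDyer.Theorems.PointSystemWithRootsOnGivenFrame

-- `K : Type`: the tree's ring-class class field theory is universe `0`.
variable {K : Type} [Field K] [NumberField K] {N : ℕ} {W : WeierstrassCurve ℚ}

/-! ## §0 Clause (c) on a given frame from a conductor-`1` datum and the `K`-rational point under `P(1)` -/

/-- **`P(1)` does not depend on the conductor-`1` datum**: two Kolyvagin–Heegner data `d, e` of conductor `1` on one
frame `(Dt, β, ι)` have the same `y(1)` (both map to `φ(x(1))` under the injective `E(K[1]) → E(ℂ)`, field `map_y`)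
and the same system of representatives `S = 𝒢_1` (`KolyvaginHeegnerData.mem_S_iff`), hence the same
`P(1) = Σ_{s ∈ 𝒢_1} s·y(1) = Tr_{K[1]/K} y(1)` (`derivedPoint_one`). [cite: GrossLMS1991, §4 (P_1 = Tr y_1 = y_K)] -/
theorem derivedPoint_eq_of_conductor_one [NeZero N] [W.IsElliptic] {Dt : ModularParametrizationData W N} {β : ℤ}
    {ι : K →+* ℂ} (d e : KolyvaginHeegnerData Dt β ι 1) : e.derivedPoint = d.derivedPoint := by
  have hy : e.y = d.y :=
    Affine.Point.map_injective (W' := W) (f := (ringClassField K ι 1).subtype.toRatAlgHom)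
      (by rw [e.map_y, d.map_y])
  have hS : e.S = d.S := by
    ext g
    rw [e.mem_S_iff, d.mem_S_iff]
  rw [e.derivedPoint_one, d.derivedPoint_one, hy, hS]

/-- **Clause (c) on the GIVEN frame.**  If `P ∈ E(K)` maps to `P(1) = d₁.derivedPoint` in `E(K[1])` for ONE
conductor-`1` datum `d₁` on `(Dt, β, ι)` (the `K`-rational Heegner point under `P(1)`, hand 8's
`…EpsilonLineOnHTwo` §1), then EVERY conductor-`1` datum `d` on `(Dt, β, ι)` has
`d.toGeomPoints d.derivedPoint = toGeomPoints (W⁄K) P` in `E(K̄)`: `P_d(1) = P_{d₁}(1)` (`derivedPoint_eq_of_conductor_one`)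
and `E(K) → E(K[1]) → E(K̄)` is `E(K) → E(K̄)` (x11b3-p1 `KolyvaginBottom.toGeomPoints_map_algebraMap`).  This is the
input `hc1` of §1 — what hand 7's machine obtained from `exists_frame_of_isHeegnerPoint`. Unconditional.
[cite: GrossLMS1991, §4 (4.1) and the remark P_1 = y_K] -/
theorem toGeomPoints_derivedPoint_one_eq_of_map_eq [NeZero N] [W.IsElliptic]
    {Dt : ModularParametrizationData W N} {β : ℤ} {ι : K →+* ℂ} (d₁ : KolyvaginHeegnerData Dt β ι 1)
    {P : (W.baseChange K).toAffine.Point}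
    (hmap : Affine.Point.map (W' := W) (algebraMap K (ringClassField K ι 1)).toRatAlgHom P = d₁.derivedPoint)
    (d : KolyvaginHeegnerData Dt β ι 1) :
    d.toGeomPoints d.derivedPoint = toGeomPoints (W.baseChange K) P := by
  rw [derivedPoint_eq_of_conductor_one d₁ d, ← hmap, KolyvaginBottom.toGeomPoints_map_algebraMap]

/-! ## §1 The assembly with roots at any prime `p`, frame as input -/

/-- **The `hpoints` binder at one prime `p` assembled by per-level choice ON A GIVEN FRAME, WITH THE ROOT CLAUSE (r)
AND THE DATUM CLAUSE (s)** — hand 7's `PointSystemWithRoots.hpoints_at_with_roots_of_perLevelChoice` (= ty2's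
`PointSystemHloc.hpoints_at_of_perLevelChoice_of_admissible_of_h44_of_hloc` + (r)) verbatim, except that the frame
`(Dt, β, ι)` with `4N ∣ β² − d_K` (`hβ`) and clause (c) on it (`hc1`) are INPUTS (no `exists_frame_of_isHeegnerPoint`,
no `hrec`); inputs `hCM`, `h53`, `hloc`, `hAdm`, `h44` as there.  At every Kolyvagin level `m` the output carries
(r) «`∀ k, (∀ e : KolyvaginHeegnerData Dt β ι m, ∃ Q₀, p^k Q₀ = P_e(m)) → ∃ Q ∈ A m, p^k Q = P_m`» and
(s) «`∃ e : KolyvaginHeegnerData Dt β ι m, A m = e.pointsSubgroup ∧ P_m = e.toGeomPoints e.derivedPoint`».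
[cite: GrossLMS1991, §3, Prop. 3.7 (2), §4 (4.1), Lemma 4.3, Props. 5.3, 5.4 (1), 6.2 (1)]
[cite: McCallumLMS1991, §4 (4)–(6), Lemma 4.3, Prop. 4.4, §5 (before Prop. 5.2)] [cite: Darmon2004, Thm. 3.7, Prop. 3.11] -/
theorem hpoints_at_with_roots_onFrame_of_perLevelChoice [NeZero N] [W.IsGloballyMinimal]
    [W.IsElliptic] (hN : N = W.conductorNorm ℤ) (hK : IsImaginaryQuadratic K)
    (hD34 : NumberField.discr K ≠ -3 ∧ NumberField.discr K ≠ -4)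
    (hH : SatisfiesHeegnerHypothesis N K) {P : (W.baseChange K).toAffine.Point}
    (hHP : IsHeegnerPoint N W K P) {p : ℕ} (hp : p.Prime)
    (Dt : ModularParametrizationData W N) (β : ℤ) (ι : K →+* ℂ)
    (hβ : (4 * N : ℤ) ∣ β ^ 2 - NumberField.discr K)
    (hc1 : ∀ d : KolyvaginHeegnerData Dt β ι 1, d.toGeomPoints d.derivedPoint = toGeomPoints (W.baseChange K) P)
    (hCM : ∀ [W.IsElliptic] (_hK : IsImaginaryQuadratic K) (_hH : SatisfiesHeegnerHypothesis N K)
      (Dt : ModularParametrizationData W N) (β : ℤ) (ι : K →+* ℂ),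
      (4 * N : ℤ) ∣ β ^ 2 - NumberField.discr K →
      ∀ {M : ℕ}, 1 ≤ M → ∀ (m : ℕ), Squarefree m →
      (∀ q ∈ m.primeFactors, IsKolyvaginPrime N W K p q ∧ FrobEqFrobInfty W K (p ^ M) q) →
      ∃ y : (W.baseChange (ringClassField K ι m)).toAffine.Point,
        WeierstrassCurve.Affine.Point.map (W' := W) (ringClassField K ι m).subtype.toRatAlgHom y =
          heegnerPointComplexOfConductor Dt (NumberField.discr K) β m)
    (h53 : ∀ [W.IsElliptic] (_hK : IsImaginaryQuadratic K) (_hH : SatisfiesHeegnerHypothesis N K)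
      (Dt : ModularParametrizationData W N) (β : ℤ) (ι : K →+* ℂ) {M : ℕ}
      (_hM : 1 ≤ M) {n : ℕ} (_hn : Squarefree n)
      (_hKol : ∀ q ∈ n.primeFactors, IsKolyvaginPrime N W K p q ∧ FrobEqFrobInfty W K (p ^ M) q)
      (d : (m : ℕ) → m ∣ n → KolyvaginHeegnerData Dt β ι m) (m : ℕ) (hm : m ∣ n)
      (τm : ringClassField K ι m ≃ₐ[ℚ] ringClassField K ι m),
      (∀ x : ringClassField K ι m, ((τm x : ringClassField K ι m) : ℂ) = starRingEnd ℂ x) →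
      ∃ σ' ∈ ringClassGal ι m, IsOfFinAddOrder
        (pointGalHom W (ringClassField K ι m) τm (d m hm).y -
          (-W.rootNumber) • pointGalHom W (ringClassField K ι m) σ' (d m hm).y))
    (hloc : ∀ (Dt : ModularParametrizationData W N) (β : ℤ) (ι : K →+* ℂ) {M : ℕ} (_hM : 1 ≤ M)
      {n : ℕ} (_hn : Squarefree n)
      (_hKol : ∀ q ∈ n.primeFactors, IsKolyvaginPrime N W K p q ∧ FrobEqFrobInfty W K (p ^ M) q)
      (d : (m : ℕ) → m ∣ n → KolyvaginHeegnerData Dt β ι m)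
      (_hA : ∀ (m : ℕ) (hm : m ∣ n),
        IsAdmissible (absoluteGaloisGroup K) (d m hm).pointsSubgroup ((p ^ M : ℕ) : ℤ)),
      ∀ (m : ℕ) (hm : m ∣ n) (v : HeightOneSpectrum (𝓞 K)), (m : 𝓞 K) ∉ v.asIdeal →
        (d m hm).kolyvaginClass hp M ∈
          selmerLocalKer (W.baseChange K) (v.adicCompletion K) ((p ^ M : ℕ) : ℤ))
    (hAdm : ∀ (Dt : ModularParametrizationData W N) (β : ℤ) (ι : K →+* ℂ) {M : ℕ} {n : ℕ},
      Squarefree n →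
      (∀ q ∈ n.primeFactors, IsKolyvaginPrime N W K p q ∧ FrobEqFrobInfty W K (p ^ M) q) →
      ∀ d : KolyvaginHeegnerData Dt β ι n,
        IsAdmissible (absoluteGaloisGroup K) d.pointsSubgroup ((p ^ M : ℕ) : ℤ))
    (h44 : ∀ [W.IsElliptic] [W.IsGloballyMinimal] (_hK : IsImaginaryQuadratic K) (ι : K →+* ℂ)
      {P : (W.baseChange K).toAffine.Point} (_hHP : IsHeegnerPoint N W K P) {M : ℕ} (_hM : 1 ≤ M)
      (Dt : ModularParametrizationData W N) {β : ℤ}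
      (_hND : IsCoprime (N : ℤ) (NumberField.discr K)) (_hD : NumberField.discr K < -4)
      {n : ℕ} (_hn : Squarefree n)
      (_hKol : ∀ q ∈ n.primeFactors, IsKolyvaginPrime N W K p q ∧ FrobEqFrobInfty W K (p ^ M) q)
      (d : (m : ℕ) → m ∣ n → KolyvaginHeegnerData Dt β ι m)
      (_hcoh : ∀ (m : ℕ) (hm : m ∣ n) (ℓ : ℕ) (hℓ : ℓ ∈ m.primeFactors)
        (hle : ringClassField K ι (m / ℓ) ≤ ringClassField K ι m),
        letI : Algebra K ℂ := ι.toAlgebra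
        (d m hm).toGeomPoints
            (KolyvaginOperator.derivedPoint (pointGalHom W (ringClassField K ι m)) (d m hm).σ (m / ℓ)
              (d m hm).S
              (WeierstrassCurve.Affine.Point.map (W' := W)
                ((RingClassField.inclusion ι hle).restrictScalars ℚ)
                (d (m / ℓ) ((Nat.div_dvd_of_dvd (Nat.dvd_of_mem_primeFactors hℓ)).trans hm)).y)) =
          (d (m / ℓ) ((Nat.div_dvd_of_dvd (Nat.dvd_of_mem_primeFactors hℓ)).trans hm)).toGeomPoints
            (d (m / ℓ) ((Nat.div_dvd_of_dvd (Nat.dvd_of_mem_primeFactors hℓ)).trans hm)).derivedPoint)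
      (_hA : ∀ (m : ℕ) (hm : m ∣ n),
        IsAdmissible (absoluteGaloisGroup K) (d m hm).pointsSubgroup ((p ^ M : ℕ) : ℤ))
      (_hPt : ∀ (m : ℕ) (hm : m ∣ n),
        (d m hm).toGeomPoints (d m hm).derivedPoint ∈
          invPoints (absoluteGaloisGroup K) (d m hm).pointsSubgroup ((p ^ M : ℕ) : ℤ))
      (_hI : ∀ (m : ℕ) (hm : m ∣ n), ∀ v : HeightOneSpectrum (𝓞 K), (m : 𝓞 K) ∉ v.asIdeal →
        ∀ 𝔐 ∈ v.localPrimesAbove, ∀ t ∈ 𝔐.inertia (absoluteGaloisGroup (v.adicCompletion K)),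
          resGal (K := K) (v.adicCompletion K) t • (d m hm).toGeomPoints (d m hm).derivedPoint =
            (d m hm).toGeomPoints (d m hm).derivedPoint),
      ∀ (m : ℕ) (hm : m ∣ n) (ℓ : ℕ), ℓ.Prime → ∀ (hℓm : ℓ ∣ m) (v : HeightOneSpectrum (𝓞 K)),
        (ℓ : 𝓞 K) ∈ v.asIdeal → ∀ a : ℕ,
          (((p : ℤ) ^ a) • (d m hm).kolyvaginClass hp M ∈
              selmerLocalKer (W.baseChange K) (v.adicCompletion K) ((p ^ M : ℕ) : ℤ) ↔
            ((p : ℤ) ^ a) • (d (m / ℓ) ((Nat.div_dvd_of_dvd hℓm).trans hm)).kolyvaginClass hp M ∈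
              (W.baseChange K).torsionLocalKer (v.adicCompletion K) ((p ^ M : ℕ) : ℤ))) :
    ∀ {M : ℕ} (_hM : 1 ≤ M)
      (hdiv : ∀ Q : geomPoints (W.baseChange K), ∃ R, ((p ^ M : ℕ) : ℤ) • R = Q)
      (c : K ≃ₐ[ℚ] K) (_hc : c ≠ 1),
      ∃ (ε : ℤ) (τ : AlgebraicClosure K ≃+* AlgebraicClosure K) (hτ : IsLiftOfAut c τ)
        (A : ℕ → AddSubgroup (geomPoints (W.baseChange K)))
        (hA : ∀ m, KolyvaginCocycle.IsAdmissible (Field.absoluteGaloisGroup K) (A m)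
          ((p ^ M : ℕ) : ℤ))
        (Pt : ℕ → geomPoints (W.baseChange K))
        (hPt : ∀ m, Pt m ∈
          KolyvaginCocycle.invPoints (Field.absoluteGaloisGroup K) (A m) ((p ^ M : ℕ) : ℤ)),
        (ε = 1 ∨ ε = -1) ∧
        IsOfFinAddOrder (Affine.Point.map (W' := W) (c : K →ₐ[ℚ] K) P - ε • P) ∧
        (∀ m, ∀ a ∈ A m, hτ.pointsMap W a ∈ A m) ∧
        Pt 1 = toGeomPoints (W.baseChange K) P ∧
        (∀ m : ℕ, Squarefree m →
          (∀ q ∈ m.primeFactors, IsKolyvaginPrime N W K p q ∧ FrobEqFrobInfty W K (p ^ M) q) →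
          (∃ B ∈ A m, hτ.pointsMap W (Pt m) =
            (ε * (-1) ^ m.primeFactors.card) • Pt m + ((p ^ M : ℕ) : ℤ) • B) ∧
          (∀ v : HeightOneSpectrum (𝓞 K), (m : 𝓞 K) ∉ v.asIdeal →
            kolyvaginClass (W.baseChange K) _ hdiv (hA m) (Pt m) (hPt m) ∈
              selmerLocalKer (W.baseChange K) (v.adicCompletion K) ((p ^ M : ℕ) : ℤ)) ∧
          (∀ ℓ : ℕ, ℓ.Prime → ℓ ∣ m → ∀ v : HeightOneSpectrum (𝓞 K), (ℓ : 𝓞 K) ∈ v.asIdeal →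
            ∀ a : ℕ, (((p : ℤ) ^ a) •
                kolyvaginClass (W.baseChange K) _ hdiv (hA m) (Pt m) (hPt m) ∈
                selmerLocalKer (W.baseChange K) (v.adicCompletion K) ((p ^ M : ℕ) : ℤ) ↔
              ((p : ℤ) ^ a) • kolyvaginClass (W.baseChange K) _ hdiv (hA (m / ℓ)) (Pt (m / ℓ))
                  (hPt (m / ℓ)) ∈
                (W.baseChange K).torsionLocalKer (v.adicCompletion K) ((p ^ M : ℕ) : ℤ))) ∧
          (∀ k : ℕ, (∀ e : KolyvaginHeegnerData Dt β ι m,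
              ∃ Q₀ : (W.baseChange (ringClassField K ι m)).toAffine.Point,
                (((p : ℕ) : ℤ) ^ k) • Q₀ = e.derivedPoint) →
            ∃ Q ∈ A m, (((p : ℕ) : ℤ) ^ k) • Q = Pt m) ∧
          (∃ e : KolyvaginHeegnerData Dt β ι m,
            A m = e.pointsSubgroup ∧ Pt m = e.toGeomPoints e.derivedPoint)) := by
  intro M hM hdiv c hc
  have hD : NumberField.discr K < -4 := discr_lt_neg_four hK hD34
  have hND := isCoprime_discr_of_satisfiesHeegnerHypothesis hK hH
  -- the frame `(Dt, β, ι)` is GIVEN, with `hβ` and clause (c) `hc1` on it (hand 7: `exists_frame_of_isHeegnerPoint`)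
  let Kol : ℕ → Prop := fun m ↦ Squarefree m ∧
    ∀ q ∈ m.primeFactors, IsKolyvaginPrime N W K p q ∧ FrobEqFrobInfty W K (p ^ M) q
  let lev : ℕ → ℕ := fun m ↦ if Kol m then m else 1
  have hKol1 : Kol 1 := ⟨squarefree_one, by simp⟩
  have hlev : ∀ m, Kol (lev m) := fun m ↦ by
    by_cases h : Kol m <;> simp only [lev, if_pos, if_neg, h, hKol1, not_false_eq_true]
  have hlev_eq : ∀ m, Kol m → lev m = m := fun m h ↦ if_pos h
  have hlev0 : ∀ m, lev m ≠ 0 := fun m ↦ Squarefree.ne_zero (hlev m).1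
  have hinert : ∀ m, ∀ q ∈ (lev m).primeFactors, (Ideal.span {(q : 𝓞 K)}).IsPrime :=
    fun m q hq ↦ ((hlev m).2 q hq).1.2.2.2.2.1
  have hKdiv : ∀ (m k : ℕ), k ∣ lev m → Kol k := fun m k hk ↦ ⟨(hlev m).1.squarefree_of_dvd hk,
    fun q hq ↦ (hlev m).2 q (Nat.primeFactors_mono hk (hlev0 m) hq)⟩
  -- CM data `y(k) ∈ E(K[k])` at the divisors of every `lev m` (labelled input `hCM` at `p`)
  have hy0 : ∀ (m k : ℕ), k ∣ lev m → ∃ y : (W.baseChange (ringClassField K ι k)).toAffine.Point,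
      WeierstrassCurve.Affine.Point.map (W' := W) (ringClassField K ι k).subtype.toRatAlgHom y =
        heegnerPointComplexOfConductor Dt (NumberField.discr K) β k :=
    fun m k hk ↦ hCM hK hH Dt β ι hβ hM k (hKdiv m k hk).1 (hKdiv m k hk).2
  choose y hy using hy0
  -- the coherent tower with top `lev m` (x11b3-p8) — ONE choice per level
  choose T hTy hTord hTσ hTβ1 hTgeom hTcoh using fun m ↦
    RingClassTower.exists_coherent_kolyvaginHeegnerData Dt hK ι (n := lev m) (hlev m).1
      (hinert m) hβ (y m) (hy m)
  have hKolT := fun m ↦ (hlev m).2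
  -- admissibility of every `E(K[k]) ⊆ E(K̄)` in the towers: the image binder is FREE (x11b3-p3)
  -- admissibility of every `E(K[k]) ⊆ E(K̄)` in the towers: the LABELLED input `hAdm`
  have hA : ∀ (m k : ℕ) (hk : k ∣ lev m),
      IsAdmissible (absoluteGaloisGroup K) (T m k hk).pointsSubgroup ((p ^ M : ℕ) : ℤ) :=
    fun m k hk ↦ hAdm Dt β ι (hKdiv m k hk).1 (hKdiv m k hk).2 (T m k hk)
  -- `hPt` (McCallum (4), x11b3-p4) and `hI` (L4.3 inertia) at the level data of `exists_levelData`
  have hPtI : ∀ m : ℕ,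
      (∀ (k : ℕ) (hk : k ∣ lev m),
        (T m k hk).toGeomPoints (T m k hk).derivedPoint ∈
          invPoints (absoluteGaloisGroup K) (T m k hk).pointsSubgroup ((p ^ M : ℕ) : ℤ)) ∧
      (∀ (k : ℕ) (hk : k ∣ lev m), ∀ v : HeightOneSpectrum (𝓞 K), (k : 𝓞 K) ∉ v.asIdeal →
        ∀ 𝔐 ∈ v.localPrimesAbove, ∀ t ∈ 𝔐.inertia (absoluteGaloisGroup (v.adicCompletion K)),
          resGal (K := K) (v.adicCompletion K) t • (T m k hk).toGeomPoints (T m k hk).derivedPoint =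
            (T m k hk).toGeomPoints (T m k hk).derivedPoint) := by
    intro m
    have hn := (hlev m).1
    choose σ H f yy π j e hord hj hπρ hfsec hHρ hdict hjunk using
      fun k ↦ KolyvaginH44.exists_levelData (W := W) (Dt := Dt) (β := β) hK ι hn (hinert m) (T m) k
    letI hcg : ∀ k, CommGroup (ringClassGal ι k) := fun k ↦ { mul_comm := fun a b ↦
      (KolyvaginH44.isMulCommutative_ringClassGal' hK ι k).is_comm.comm a b }
    haveI hfin : ∀ k, Finite (ringClassGal ι k) := KolyvaginH44.finite_ringClassGal hK ι
    letI act : ∀ k, DistribMulAction (ringClassGal ι k)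
        ((W.baseChange (ringClassField K ι k)).toAffine.Point) := fun k ↦
      DistribMulAction.compHom _ ((pointGalHom W _).comp (ringClassGal ι k).subtype)
    letI hft : ∀ k, Fintype (ringClassGal ι k ⧸ H k) := fun k ↦ Fintype.ofFinite _
    have hsmul : ∀ (k) (g : ringClassGal ι k)
        (Q : (W.baseChange (ringClassField K ι k)).toAffine.Point), g • Q =
        pointGalHom W _ (g : ringClassField K ι k ≃ₐ[ℚ] ringClassField K ι k) Q := fun _ _ _ ↦ rfl
    set ρ : ∀ k, ringClassGal ι k →* (ringClassField K ι k ≃ₐ[ℚ] ringClassField K ι k) :=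
      fun k ↦ (ringClassGal ι k).subtype with hρdef
    have hρi : ∀ k, Function.Injective (ρ k) := fun k ↦ (ringClassGal ι k).subtype_injective
    have hj' : ∀ (k) (g : absoluteGaloisGroup K)
        (a : (W.baseChange (ringClassField K ι k)).toAffine.Point),
        j k (π k g • a) = g • j k a := fun k g a ↦ by rw [hsmul]; exact hj k g a
    have hπρ' : ∀ (k) (τ : absoluteGaloisGroup K) (x : ringClassField K ι k),
        τ • e k x = e k (ρ k (π k τ) x) := fun k τ x ↦ hπρ k τ x
    -- G1: the abstract Kolyvagin point IS `P(k)` at the divisors (x11b3-p8)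
    have hP : ∀ (k) (hk : k ∣ lev m),
        j k (kolyvaginPoint (σ k) k.primeFactors (f k) (yy k)) =
          (T m k hk).toGeomPoints (T m k hk).derivedPoint := by
      intro k hk
      obtain ⟨hjk, hyk, hσk, hfS⟩ := hdict k hk
      rw [hjk, hyk]
      congr 1
      have hbij := KolyvaginH37Bridge.bijOn_of_section_of_transversal (ρ k) (hρi k)
        (H := H k) (Γ := ringClassGal ι k) (G₁ := ringClassGalOver ι k 1) (hHρ k)
        (S := ((T m k hk).S : Set _)) (fun s hs ↦ (T m k hk).S_subset s hs)
        (fun s hs ↦ ⟨⟨s, (T m k hk).S_subset s hs⟩, rfl⟩) (T m k hk).S_transversal (f k) (hfsec k)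
        hfS
      exact KolyvaginH37Bridge.map_kolyvaginPoint_eq_derivedPoint
        (pointGalHom W (ringClassField K ι k)) (ρ k) (AddMonoidHom.id _) (fun g a ↦ hsmul k g a)
        (hn.squarefree_of_dvd hk) hσk (f k) hbij (T m k hk).y
    have hyA := fun (k : ℕ) (hk : k ∣ lev m) ↦ (hdict k hk).2.1
    have hσA := fun (k : ℕ) (hk : k ∣ lev m) ↦ (hdict k hk).2.2.1
    refine ⟨fun k hk ↦ ?_, fun k hk w hkw 𝔐 h𝔐 t ht ↦ ?_⟩
    · have h := KolyvaginH44.kolyvaginPoint_mem_invPoints_of_dvd hK ι Dt hp hM hND hD hn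
        (hKolT m) (T m) σ (fun k ↦ k.primeFactors) H f yy π j hj' ρ hρi (fun _ ↦ AddEquiv.refl _)
        (fun k _ g a ↦ hsmul k g a) hyA hσA (fun _ _ ↦ rfl) (fun k _ ↦ hfsec k) (fun k _ ↦ hHρ k)
        k hk
      rwa [hP k hk, (hdict k hk).1] at h
    · exact hP k hk ▸ KolyvaginH44.smul_kolyvaginPoint_eq_of_mem_localInertia (W := W) hK ι σ
        (fun k ↦ k.primeFactors) H f yy π j hj' e ρ hρi hπρ' k w hkw 𝔐 h𝔐 t ht
  -- the concrete classes of the per-level data are McCallum's classes of `P(lev m)` (any `hdiv`)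
  have hcl : ∀ m : ℕ,
      kolyvaginClass (W.baseChange K) ((p ^ M : ℕ) : ℤ) hdiv (hA m (lev m) dvd_rfl)
          ((T m (lev m) dvd_rfl).toGeomPoints (T m (lev m) dvd_rfl).derivedPoint)
          ((hPtI m).1 (lev m) dvd_rfl) =
        (T m (lev m) dvd_rfl).kolyvaginClass hp M := fun m ↦ by
    rw [KolyvaginHeegnerData.kolyvaginClass_of_admissible _ hp M (hA m _ dvd_rfl)
      ((hPtI m).1 _ dvd_rfl)]
  -- same-level choice independence up to a unit (B2, x11b3-p2 GEN 12), across a level cast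
  have hB2 : ∀ (m₀ k : ℕ) (hk : k ∣ lev m₀) (k' : ℕ), k' = k →
      ∀ (d' : KolyvaginHeegnerData Dt β ι k')
        (H : AddSubgroup (galH1Torsion (W.baseChange K) ((p ^ M : ℕ) : ℤ))) (t : ℤ),
        t • d'.kolyvaginClass hp M ∈ H ↔ t • (T m₀ k hk).kolyvaginClass hp M ∈ H := by
    intro m₀ k hk k' hkk' d' H t; subst k'
    exact KolyvaginChoice.zsmul_kolyvaginClass_mem_iff hK ι Dt hp hM hND hD (hlev m₀).1 (hKolT m₀)
      (T m₀) hk d' (hA m₀ k hk) H t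
  have hc1' : ∀ (k : ℕ), k = 1 → ∀ d : KolyvaginHeegnerData Dt β ι k,
      d.toGeomPoints d.derivedPoint = toGeomPoints (W.baseChange K) P := by
    rintro _ rfl d; exact hc1 d
  -- ASSEMBLY: `ε := −w(E)`, `τ := liftAut c`, `A m := E(K[lev m])`, `P_m := P(lev m)`
  refine ⟨-W.rootNumber, liftAut c, isLiftOfAut_liftAut c,
    fun m ↦ (T m (lev m) dvd_rfl).pointsSubgroup, fun m ↦ hA m (lev m) dvd_rfl,
    fun m ↦ (T m (lev m) dvd_rfl).toGeomPoints (T m (lev m) dvd_rfl).derivedPoint,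
    fun m ↦ (hPtI m).1 (lev m) dvd_rfl, ?_, ?_, ?_, ?_, ?_⟩
  · rcases W.rootNumber_eq_one_or with h | h -- (a) the sign
    · exact Or.inr (by rw [h])
    · exact Or.inl (by rw [h, neg_neg])
  · exact isOfFinAddOrder_map_sub_of_eq_conductorNorm hN hK hH hHP c hc -- (a) Darmon Prop. 3.11
  · exact fun m ↦ RingClassConj.pointsMap_mem_pointsSubgroup hK (hlev0 m) (T m (lev m) dvd_rfl)
      (isLiftOfAut_liftAut c) -- (b) `τ`-stability of every `E(K[lev m])` (x11b3-p8)
  · exact hc1' (lev 1) (hlev_eq 1 hKol1) _ -- (c) `P_1 = y_K` (x11b3-p1, modulo `hrec`)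
  · -- (d), (e), (f), (r), (s) at a Kolyvagin level `m` (so `lev m = m`)
    intro m hmsq hmkol
    have hlm : lev m = m := hlev_eq m ⟨hmsq, hmkol⟩
    refine ⟨?_, ?_, ?_, ?_, ?_⟩
    · -- (d) Gross Prop. 5.4 (1) (x11b3-p2 p301428), modulo (A′-53) at `ε = −w(E)`
      obtain ⟨B, hB, hBeq⟩ := KolyvaginTauEigen.pointsMap_derivedPoint_concrete_of_prop53 hK ι hp hM
        Dt hND hD (hlev m).1 (hKolT m) (T m) hc (isLiftOfAut_liftAut c) (-W.rootNumber)
        (h53 hK hH Dt β ι hM (hlev m).1 (hKolT m) (T m)) (hA m) (lev m) dvd_rfl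
      have hpf : (lev m).primeFactors = m.primeFactors := by rw [hlm]
      exact ⟨B, hB, by rwa [hpf] at hBeq⟩
    · -- (e) Gross Prop. 6.2 (1) / McCallum L4.3 at `v ∤ m`: the LABELLED input `hloc` on the tower `T m`
      intro v hv
      have hv' : ((lev m : ℕ) : 𝓞 K) ∉ v.asIdeal := by rw [hlm]; exact hv
      have h := hloc Dt β ι hM (hlev m).1 (hKolT m) (T m) (hA m) (lev m) dvd_rfl v hv'
      rwa [← hcl m] at h
    · -- (f) McCallum Prop. 4.4 at `λ ∣ m`: the LABELLED input `h44` inside `T m`; then B2 to `D (m/ℓ)`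
      intro ℓ hℓ hℓm v hv a
      have hℓlm : ℓ ∣ lev m := by rw [hlm]; exact hℓm
      have hKol' : Kol (m / ℓ) := hKdiv m (m / ℓ) (by rw [hlm]; exact Nat.div_dvd_of_dvd hℓm)
      have hlev' : lev (m / ℓ) = lev m / ℓ := by rw [hlev_eq _ hKol', hlm]
      have h44' := h44 hK ι hHP hM Dt hND hD (hlev m).1 (hKolT m) (T m) (hTcoh m) (hA m)
        (hPtI m).1 (hPtI m).2 (lev m) dvd_rfl ℓ hℓ hℓlm v hv a
      rw [hcl m, hcl (m / ℓ), h44']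
      exact (hB2 m (lev m / ℓ) ((Nat.div_dvd_of_dvd hℓlm).trans dvd_rfl) (lev (m / ℓ)) hlev'
        (T (m / ℓ) (lev (m / ℓ)) dvd_rfl) _ _).symm
    · -- (r) ROOTS ON THE GIVEN FRAME: a `p^k`-th root of `P_e(m)` in `E(K[m])` for every datum `e` on `(Dt, β, ι)`
      -- gives one of `P_m` in `A m = E(K[lev m])` — the tower's datum `T m (lev m)` IS such an `e`
      intro k hk
      have hk' : ∀ e : KolyvaginHeegnerData Dt β ι (lev m),
          ∃ Q₀ : (W.baseChange (ringClassField K ι (lev m))).toAffine.Point,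
            (((p : ℕ) : ℤ) ^ k) • Q₀ = e.derivedPoint := by
        rw [hlm]; exact hk
      obtain ⟨Q₀, hQ₀⟩ := hk' (T m (lev m) dvd_rfl)
      exact ⟨(T m (lev m) dvd_rfl).toGeomPoints Q₀, ⟨Q₀, rfl⟩, by rw [← map_zsmul, hQ₀]⟩
    · -- (s) the level-`m` member of the tower is a datum of conductor `m` on the given frame (across the cast `lev m = m`)
      have key : ∀ (m' : ℕ), m' = m → ∀ e' : KolyvaginHeegnerData Dt β ι m',
          ∃ e : KolyvaginHeegnerData Dt β ι m,
            e'.pointsSubgroup = e.pointsSubgroup ∧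
              e'.toGeomPoints e'.derivedPoint = e.toGeomPoints e.derivedPoint := by
        rintro _ rfl e'
        exact ⟨e', rfl, rfl⟩
      exact key (lev m) hlm (T m (lev m) dvd_rfl)

end Summit.BirchSwinnertonDyer.BirchSwinnertonDyer.Theorems.PointSystemWithRootsOnGivenFrame

end
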